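import Summits.BirchSwinnertonDyer.BirchSwinnertonDyer.Theorems.ClassRecordThreeCornerAtThreeControlOfFacts
import Summits.BirchSwinnertonDyer.BirchSwinnertonDyer.Theorems.ErratumRoadFiveBaseCountShaPrimary
import Summits.BirchSwinnertonDyer.BirchSwinnertonDyer.Theorems.ErratumRoadFiveControlFromJSWMult
import Summits.BirchSwinnertonDyer.BirchSwinnertonDyer.Theorems.SchneiderFreeAdditiveX3KYReadEmbAtCompat
import Summits.BirchSwinnertonDyer.Rank1Residual.X11b.CW53CompositeOfFrames
import HarnessLib

/-!
# Route `ErratumRoadFive` (rung K2), support item 19626: **Jetchev–Skinner–Wan 2017 Thm. 3.3.1 at a multiplicative `p`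
# (`JetchevSkinnerWan2017.thm331_anticyclotomicControl_mult`, the item VERBATIM) FROM THE TWO POITOU–TATE FACTS** —
# the tree's kernel control theorem re-assembled on JSW's own hypotheses (`rank E(K) = 1`, `Ш(E/K)[p^∞]` finite, any `ι`)
# (cell `bsd-stepL`, seat `bsd-stepL-imc-p1` g16; `--supports stmt-BirchSwinnertonDyer-19626`; Theses-free)

HONEST FRAMING: theorems only (no definition, no named fact, no `sorry`); the main theorem is CONDITIONAL on the two cited
Literature facts `poitouTate_selmerStructure_duality` (Milne ADT I 4.10 for Selmer structures) and `poitouTate_sha_tateDual`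
(Poitou–Tate ∕ Cassels–Tate for `Ш`), taken BY NAME as hypotheses — a conditional-result for item 19626, which therefore does NOT
close; Brink Thm. 2, Milne I 2.8 (local Euler–Poincaré) and `cd_p ≤ 2` are tree theorems and are discharged. Nothing about BSD is
proved; no census word, tier or label moves (T7).

## What this file proves

corner3-p2's `X11b.controlOnTreeAt_of_mult_of_rankOne_odd` (over bsd-eis `CtlLoc.controlOnTreeAt_of_split_anyTorsion` and
bsd-schneider `X2.controlOnTreeAt_of_not_split_of_rankOne`) states the control identity at data keyed by `ord_{s=1} L(E,s) = 1` and
`L(E^{(d_K)},1) ≠ 0` (whence `rank E(K) = 1` and ALL of `Ш(E/K)` finite by GZK), at THE embedding `embAt`. JSW17 Thm. 3.3.1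
(item 19626) is keyed differently: `rank E(K) = 1` and `#Ш(E/K)[p^∞] < ∞` are INPUTS, `ι : K → ℚ_p` is any embedding inducing
the strict prime `v`, and (irred_K) is assumed (unused here: control is image-free). This file closes the gap:

* §1 `CtlLoc.controlOnTreeAt_of_split_of_rankOne_shaPrimary` — the split case, proof VERBATIM from
  `controlOnTreeAt_of_split_anyTorsion` with `(hrank, hSha : Finite Ш[p^∞])` in place of `(hr, hLt)` and the `Ш[p^∞]` base count
  `natCard_selmerAcBase_mul_eq_of_rankOne_anyTorsion_shaPrimary` (`Theorems/ErratumRoadFiveBaseCountShaPrimary.lean`).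
* §2 `baseSelmerCountAt_of_not_split_of_rankOne_shaPrimary` ((P6) at a NON-split `p` from the any-torsion count: `E(ℚ_p)[p] = 0`
  kills both torsion exponents) and `controlOnTreeAt_of_not_split_of_rankOne_shaPrimary` (proof VERBATIM from
  `X2.controlOnTreeAt_of_not_split_of_rankOne`).
* §3 `controlOnTreeAt_of_mult_of_rankOne_shaPrimary` — both signs, Brink ∕ Milne I 2.8 ∕ `cd_p ≤ 2` discharged in-kernel.
* §4 `ringHom_eq_embAt_of_forall_mem_iff` (with `X11b.natCast_mem_of_forall_mem_iff_norm_lt`) — an embedding `ι : K →+* ℚ_p` of the quadratic field `K` (`p` split) inducing `v` on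
  `𝓞 K` IS `embAt K p v` (bsd-schneider's `eq_comp_embAt_of_forall_mem_iff_norm_lt_one` with `e = id`).
* §5 **`thm331_anticyclotomicControl_mult_of_poitouTate hPT hPT2 : JetchevSkinnerWan2017.thm331_anticyclotomicControl_mult`**
  — the route's support item 19626 ∕ Literature fact VERBATIM, from the two Poitou–Tate facts (defeq bridges
  `AcSelmer.hasCharValuationAt_iff_literature`, `tamagawaProductSplit_eq_literature`, `padicLogOrd_eq_literature`).

References: [JetchevSkinnerWan2017] Thm. 3.3.1, Prop. 3.2.1, Prop. 3.3.2, Lemma 3.3.3, Prop. 3.3.4 (arXiv:1512.06894 pp. 10–13),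
§3.5 (3.5.c) (p. 15); [Castella2018] Thm. 2.3 and proof (arXiv:1704.06608 pp. 5–6); [KellerYin2024] App. B Thm. B.0.6;
[Brink2007] Thm. 2, Cor. 1; [MilneADT2006] I Thm. 2.8, Thm. 4.10; [FrohlichTaylor1990] III §1 (1.14)(a).
-/

set_option autoImplicit false
set_option linter.dupNamespace false

noncomputable section

open scoped Classical

open WeierstrassCurve NumberField IsDedekindDomain Field Literature.NumberTheory.EllipticCurves
  Literature.NumberTheory.EllipticCurves.ModularForms
  Literature.NumberTheory.EllipticCurves.GreenbergSelmer
  Literature.NumberTheory.GaloisRepresentations Literature.NumberTheory.GaloisCohomology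
  Literature.NumberTheory.EllipticCurves.Rank1Residual
  Literature.NumberTheory.EllipticCurves.Rank1Residual.Typed
  Literature.NumberTheory.Automorphic
  Summit.BirchSwinnertonDyer.Rank1Residual
  Summit.BirchSwinnertonDyer.Rank1Residual.X11b
  Summit.BirchSwinnertonDyer.Rank1Residual.X11b.AcSelmer
  Summit.BirchSwinnertonDyer.Rank1Residual.X11b.LocBridge
  Summit.BirchSwinnertonDyer.Rank1Residual.X2
  Summit.BirchSwinnertonDyer.BirchSwinnertonDyer.Theorems.SchneiderFreeControlAtoms
  Summit.BirchSwinnertonDyer.BirchSwinnertonDyer.Theorems.SchneiderFreeAdditiveX3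
  Summit.Ventures.HodgeRepro2.T5DegreeOneNumberField

/-! ### §1 The split case on JSW's inputs -/

namespace Summit.BirchSwinnertonDyer.BirchSwinnertonDyer.Theorems.CtlLoc

section Split

variable (W : WeierstrassCurve ℚ) [W.IsElliptic] [W.IsGloballyMinimal] (p : ℕ) [Fact p.Prime]

/-- **The anticyclotomic control theorem at a SPLIT multiplicative odd `p`, ANY torsion, on JSW's inputs** — `rank E(K) = 1` and
`Ш(E/K)[p^∞]` finite given (not analytic rank ∕ twist `L`-value): `ControlOnTreeAt p κ 𝔭 γ (embAt K p 𝔭) P`. Proof VERBATIM from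
`controlOnTreeAt_of_split_anyTorsion` (cgshw MEMO-7 «control WITH torsion»: the global torsion exponent `g` and the local one `t`
cancel), reading the base count from `natCard_selmerAcBase_mul_eq_of_rankOne_anyTorsion_shaPrimary`. CONDITIONAL on the cited
`hPT`, `hPT2`, `hEP`, `hBr`. [cite: JetchevSkinnerWan2017, Thm. 3.3.1, Prop. 3.2.1, Prop. 3.3.4 Case 3(b) (arXiv:1512.06894 pp. 10–13)]
[cite: KellerYin2024, App. B Thm. B.0.6 (arXiv:2402.12781 pp. 29–30)] [cite: Castella2018, Thm. 2.3] [cite: Brink2007, Thm. 2 and Cor. 1] -/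
theorem controlOnTreeAt_of_split_of_rankOne_shaPrimary
    (hPT : ∀ (K : Type) [Field K] [NumberField K], poitouTate_selmerStructure_duality K)
    (hPT2 : ∀ (K : Type) [Field K] [NumberField K], poitouTate_sha_tateDual K)
    (hEP : ∀ (K : Type) [Field K] [NumberField K] (v : HeightOneSpectrum (𝓞 K)),
      localEulerPoincareCharacteristic (v.adicCompletion K))
    (hBr : ∀ (K : Type) [Field K] [NumberField K] (p : ℕ) [Fact p.Prime],
      ZpExtension.decomp_not_le_kerSubgroup_of_isAnticyclotomic K p)
    (hp2 : p ≠ 2) (hsplitW : W.HasSplitMultiplicativeReductionAtPrime p)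
    {K : Type} [Field K] [NumberField K] (hK : IsImaginaryQuadratic K) (hsplit : SplitsIn K p)
    (hrank : (W.baseChange K).mordellWeilRank = 1)
    (hSha : Finite (AddCommGroup.primaryComponent (W.baseChange K).sha p))
    (P : (W.baseChange K).toAffine.Point) (hPinf : ¬ IsOfFinAddOrder P)
    (κ : ZpExtension K p) (hκ : κ.IsAnticyclotomic) (γ : absoluteGaloisGroup K)
    [hγ : Fact (κ.IsTopGenerator γ)] (𝔭 : HeightOneSpectrum (𝓞 K))
    (h𝔭 : ((p : ℕ) : 𝓞 K) ∈ 𝔭.asIdeal) (he : 𝔭.asIdeal.ramificationIdx (𝓞 ℚ) = 1)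
    (hf : 𝔭.asIdeal.inertiaDeg (𝓞 ℚ) = 1) :
    ControlOnTreeAt p κ 𝔭 γ (embAt K p 𝔭 h𝔭 he hf) P := by
  have hp : p.Prime := Fact.out
  haveI : IsTotallyComplex K := hK.2
  haveI hEK : (W.baseChange K).IsElliptic := by rw [baseChange]; infer_instance
  have hmult : Mult W p := hsplitW.hasMultiplicativeReductionAtPrime
  have hpN : p ∣ W.conductorNorm ℤ := dvd_conductorNorm_of_mult hmult
  -- the base count at every degree-one prime above `p` (finiteness) and at `𝔭` (the count), ANY torsion
  have hfin : ∀ v : HeightOneSpectrum (𝓞 K), ((p : ℕ) : 𝓞 K) ∈ v.asIdeal →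
      Finite (selmerAcBase (W.baseChange K) p v ∅) := fun v hv ↦ by
    obtain ⟨he', hf'⟩ := degreeOne_of_splitsIn hK.1 hsplit hv
    obtain ⟨hfinv, -, -, -⟩ := natCard_selmerAcBase_mul_eq_of_rankOne_anyTorsion_shaPrimary W p K (hPT K)
      (hEP K) hK hsplit hrank hSha P hPinf v hv he' hf'
    exact hfinv
  obtain ⟨hfinSel, a, hcard, ha⟩ := natCard_selmerAcBase_mul_eq_of_rankOne_anyTorsion_shaPrimary W p K
    (hPT K) (hEP K) hK hsplit hrank hSha P hPinf 𝔭 h𝔭 he hf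
  have hns : padicValNat p (reductionPointCount W p) = 0 :=
    padicValNat.eq_zero_of_not_dvd (LocalTorsionMult.not_dvd_reductionPointCount_of_mult W p hmult)
  -- `#E(ℚ_p)[p^∞] = p^t`, `#Sel = p^(a - t)`, `t ≤ a`
  obtain ⟨t, ht⟩ := exists_natCard_primaryComponent_padic_eq_pow W p
  have hta : t ≤ a := by
    have h1 : p ^ t ∣ p ^ a := ⟨Nat.card (selmerAcBase (W.baseChange K) p 𝔭 ∅), by
      rw [mul_comm, ← ht]; exact hcard.symm⟩
    exact (Nat.pow_dvd_pow_iff_le_right hp.one_lt).mp h1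
  have hcard' : Nat.card (selmerAcBase (W.baseChange K) p 𝔭 ∅) = p ^ (a - t) := by
    have h1 : Nat.card (selmerAcBase (W.baseChange K) p 𝔭 ∅) * p ^ t = p ^ (a - t) * p ^ t := by
      rw [← pow_add, Nat.sub_add_cancel hta, ← ht]; exact hcard
    exact Nat.eq_of_mul_eq_mul_right (pow_pos hp.pos t) h1
  -- (KER-𝔭): `#ker r_𝔭 = p^t` from Fin_v (THEOREM at a split multiplicative prime) and Brink Cor. 1
  have hFin : LocalTowerTorsionFiniteAt (W.baseChange K) p κ 𝔭 :=
    localTowerTorsionFiniteAt_of_hasSplitMultiplicativeReductionAtPrime W hp2 hsplitW hK hsplit κ hκ 𝔭 h𝔭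
  have hv : ¬ decomp 𝔭 ≤ κ.kerSubgroup :=
    ZpExtension.decomp_not_le_kerSubgroup_above_of_isAnticyclotomic_holds (K := K) (p := p) hK hp2
      κ hκ 𝔭 h𝔭
  have h𝔭ker := natCard_localKer_eq_pow_of_finite W p κ 𝔭 h𝔭 he hf hFin hv ht
  -- (KER-res): `#ker res = p^g`, `p^g = #E(K)[p^∞]`
  set g := padicValNat p (Nat.card (AddCommGroup.primaryComponent (W.baseChange K).toAffine.Point p))
    with hgdef
  have hres := natCard_ker_resOfLe_top_eq_pow W p κ hp2 hK
    (pow_prime_eq_one_of_splitsIn hp2 hK hsplit 𝔭 h𝔭) hκ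
  -- (P9-𝓒) at the conjugate prime, (L10), (P11)
  obtain ⟨σ, 𝔮, -, hne, h𝔮, -⟩ :=
    LocalIndexTransport.exists_conj_prime_of_splitsIn K p hK.1 hsplit h𝔭
  have hloc := ptSurj_of_finite W p hK hsplit (hPT K) h𝔭 h𝔮 hne (hfin 𝔮 h𝔮) κ
  have h10 : CoinvariantsTrivialAt (W.baseChange K) p κ 𝔭 γ :=
    coinvariantsTrivialAt_of_finite_anyTorsion W p hK hsplit (hPT K) (hPT2 K) κ hγ.out h𝔭 hfin
  have h11 := r1LocalKernelOrderAt_of_anticyclotomicDecomposition W p hBr hp2 K hK κ hκ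
  -- assemble: `g` and `t` cancel
  refine controlOnTreeAt_of_torsAtoms hK hsplit hpN hκ γ 𝔭 h𝔭 (embAt K p 𝔭 h𝔭 he hf) P g t (a - t)
    hres h𝔭ker ⟨⟨hfinSel, hcard'⟩, ?_⟩ hloc h10 h11
  rw [Nat.cast_sub hta, ha, hns]
  push_cast
  ring

end Split

end Summit.BirchSwinnertonDyer.BirchSwinnertonDyer.Theorems.CtlLoc

/-! ### §2 The non-split case on JSW's inputs -/

namespace Summit.BirchSwinnertonDyer.BirchSwinnertonDyer.Theorems.JSWControl

section NonSplit

variable (W : WeierstrassCurve ℚ) [W.IsElliptic] [W.IsGloballyMinimal] (p : ℕ) [Fact p.Prime]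

/-- **(P6) at an odd NON-SPLIT multiplicative `p` on JSW's inputs** (`rank E(K) = 1`, `Ш(E/K)[p^∞]` finite): `BaseSelmerCountAt p 𝔭 (embAt K p 𝔭) P`
from the any-torsion count `natCard_selmerAcBase_mul_eq_of_rankOne_anyTorsion_shaPrimary`, in which `E(ℚ_p)[p] = 0`
(`X11b.LocalTorsion.localTorsion_eq_zero_of_nonsplit`) kills the local torsion factor `#E(ℚ_p)[p^∞]` and — `E(K) ↪ E(ℚ_p)` — the global
exponent `ord_p #E(K)[p^∞]`, and `p ∤ #Ẽ_ns(𝔽_p)` kills the reduction term. CONDITIONAL on the two cited cohomological facts.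
[cite: JetchevSkinnerWan2017, Prop. 3.2.1 and (7.1.5) (arXiv:1512.06894 pp. 10–11, 16)] [cite: SilvermanAEC2009, Thm VII.6.1 and Exercise 3.5] -/
theorem baseSelmerCountAt_of_not_split_of_rankOne_shaPrimary {K : Type} [Field K] [NumberField K]
    (hPT : poitouTate_selmerStructure_duality K)
    (hEP : ∀ v : HeightOneSpectrum (𝓞 K), localEulerPoincareCharacteristic (v.adicCompletion K))
    (hp3 : 3 ≤ p) (hmult : Mult W p) (hns : ¬ W.HasSplitMultiplicativeReductionAtPrime p)
    (hK : IsImaginaryQuadratic K) (hsplit : SplitsIn K p)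
    (hrank : (W.baseChange K).mordellWeilRank = 1)
    (hSha : Finite (AddCommGroup.primaryComponent (W.baseChange K).sha p))
    (P : (W.baseChange K).toAffine.Point) (hPinf : ¬ IsOfFinAddOrder P)
    (𝔭 : HeightOneSpectrum (𝓞 K)) (h𝔭 : ((p : ℕ) : 𝓞 K) ∈ 𝔭.asIdeal)
    (he : 𝔭.asIdeal.ramificationIdx (𝓞 ℚ) = 1) (hf : 𝔭.asIdeal.inertiaDeg (𝓞 ℚ) = 1) :
    BaseSelmerCountAt p 𝔭 (embAt K p 𝔭 h𝔭 he hf) P := by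
  have hp : p.Prime := Fact.out
  have hiv : ∀ R : (W.baseChange ℚ_[p]).toAffine.Point, p • R = 0 → R = 0 :=
    LocalTorsion.localTorsion_eq_zero_of_nonsplit W p hp3 hmult hns
  have hfinj : Function.Injective
      (Affine.Point.map (W' := W) (embAt K p 𝔭 h𝔭 he hf).toRatAlgHom :
        (W.baseChange K).toAffine.Point →+ (W.baseChange ℚ_[p]).toAffine.Point) :=
    Affine.Point.map_injective (W' := W) (embAt K p 𝔭 h𝔭 he hf).toRatAlgHom
  have hivK0 : ∀ Q : (W.baseChange K).toAffine.Point, p • Q = 0 → Q = 0 := by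
    intro Q hQ
    refine (injective_iff_map_eq_zero _).mp hfinj Q (hiv _ ?_)
    rw [← map_nsmul, hQ, map_zero]
  obtain ⟨hfin, a, hcard, ha⟩ := natCard_selmerAcBase_mul_eq_of_rankOne_anyTorsion_shaPrimary W p K hPT hEP
    hK hsplit hrank hSha P hPinf 𝔭 h𝔭 he hf
  have hbot : AddCommGroup.primaryComponent (W.baseChange ℚ_[p]).toAffine.Point p = ⊥ := by
    refine (AddSubgroup.eq_bot_iff_forall _).mpr fun x hx => ?_
    obtain ⟨n, hn⟩ := (AddCommGroup.mem_primaryComponent).mp hx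
    exact KummerDecomp.eq_zero_of_pow_nsmul_eq_zero p hiv n hn
  have h1 : Nat.card (AddCommGroup.primaryComponent (W.baseChange ℚ_[p]).toAffine.Point p) = 1 := by
    rw [hbot, AddSubgroup.card_bot]
  have hbotK : AddCommGroup.primaryComponent (W.baseChange K).toAffine.Point p = ⊥ := by
    refine (AddSubgroup.eq_bot_iff_forall _).mpr fun x hx => ?_
    obtain ⟨n, hn⟩ := (AddCommGroup.mem_primaryComponent).mp hx
    exact KummerDecomp.eq_zero_of_pow_nsmul_eq_zero p hivK0 n hn
  have h1K : Nat.card (AddCommGroup.primaryComponent (W.baseChange K).toAffine.Point p) = 1 := by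
    rw [hbotK, AddSubgroup.card_bot]
  have hns0 : padicValNat p (reductionPointCount W p) = 0 :=
    padicValNat.eq_zero_of_not_dvd (LocalTorsionMult.not_dvd_reductionPointCount_of_mult W p hmult)
  rw [h1, mul_one] at hcard
  refine ⟨a, ⟨hfin, hcard⟩, ?_⟩
  rw [ha, h1K, hns0, padicValNat_one_right]
  push_cast
  ring

/-- **The anticyclotomic control theorem at a NON-SPLIT multiplicative odd `p` on JSW's inputs** (`rank E(K) = 1`, `Ш(E/K)[p^∞]` finite
given): `ControlOnTreeAt p κ 𝔭 γ (embAt K p 𝔭) P`. Proof VERBATIM from `X2.controlOnTreeAt_of_not_split_of_rankOne` with (P6) from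
`baseSelmerCountAt_of_not_split_of_rankOne_shaPrimary`. CONDITIONAL on the five cited facts `hPT`, `hPT2`, `hEP`, `hcd`, `hBr`.
[cite: Castella2018, Thm. 2.3 (arXiv:1704.06608 p. 5)]
[cite: JetchevSkinnerWan2017, Thm. 3.3.1, Prop. 3.2.1, Prop. 3.3.2, Lemma 3.3.3, Prop. 3.3.4 (arXiv:1512.06894 pp. 10–13)]
[cite: Brink2007, Thm. 2 and Cor. 1 (pp. 2134–2136)] -/
theorem controlOnTreeAt_of_not_split_of_rankOne_shaPrimary
    (hPT : ∀ (K : Type) [Field K] [NumberField K], poitouTate_selmerStructure_duality K)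
    (hPT2 : ∀ (K : Type) [Field K] [NumberField K], poitouTate_sha_tateDual K)
    (hEP : ∀ (K : Type) [Field K] [NumberField K] (v : HeightOneSpectrum (𝓞 K)),
      localEulerPoincareCharacteristic (v.adicCompletion K))
    (hcd : fieldCdLE_two_of_numberField)
    (hBr : ∀ (K : Type) [Field K] [NumberField K] (p : ℕ) [Fact p.Prime],
      ZpExtension.decomp_not_le_kerSubgroup_of_isAnticyclotomic K p)
    (hp2 : p ≠ 2) (hmult : Mult W p) (hns : ¬ W.HasSplitMultiplicativeReductionAtPrime p)
    {K : Type} [Field K] [NumberField K] (hK : IsImaginaryQuadratic K)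
    (hsplit : SplitsIn K p) (hrank : (W.baseChange K).mordellWeilRank = 1)
    (hSha : Finite (AddCommGroup.primaryComponent (W.baseChange K).sha p))
    (P : (W.baseChange K).toAffine.Point) (hPinf : ¬ IsOfFinAddOrder P)
    (κ : ZpExtension K p) (hκ : κ.IsAnticyclotomic) (γ : absoluteGaloisGroup K)
    [hγ : Fact (κ.IsTopGenerator γ)] (𝔭 : HeightOneSpectrum (𝓞 K))
    (h𝔭 : ((p : ℕ) : 𝓞 K) ∈ 𝔭.asIdeal) (he : 𝔭.asIdeal.ramificationIdx (𝓞 ℚ) = 1)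
    (hf : 𝔭.asIdeal.inertiaDeg (𝓞 ℚ) = 1) :
    ControlOnTreeAt p κ 𝔭 γ (embAt K p 𝔭 h𝔭 he hf) P := by
  have hp : p.Prime := Fact.out
  have hp3 : 3 ≤ p := by
    rcases hp.eq_two_or_odd with h | h
    · exact absurd h hp2
    · have := hp.two_le
      omega
  -- (P6) at every degree-one prime above `p`
  have h6 : ∀ (𝔮 : HeightOneSpectrum (𝓞 K)) (h𝔮 : ((p : ℕ) : 𝓞 K) ∈ 𝔮.asIdeal)
      (he' : 𝔮.asIdeal.ramificationIdx (𝓞 ℚ) = 1) (hf' : 𝔮.asIdeal.inertiaDeg (𝓞 ℚ) = 1),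
      BaseSelmerCountAt p 𝔮 (embAt K p 𝔮 h𝔮 he' hf') P := fun 𝔮 h𝔮 he' hf' ↦
    baseSelmerCountAt_of_not_split_of_rankOne_shaPrimary W p (hPT K) (hEP K) hp3 hmult hns hK hsplit hrank
      hSha P hPinf 𝔮 h𝔮 he' hf'
  have hfin : ∀ v : HeightOneSpectrum (𝓞 K), ((p : ℕ) : 𝓞 K) ∈ v.asIdeal →
      Finite (selmerAcBase (W.baseChange K) p v ∅) := fun v hv ↦ by
    obtain ⟨he', hf'⟩ := degreeOne_of_splitsIn hK.1 hsplit hv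
    obtain ⟨a, ⟨hfinv, -⟩, -⟩ := h6 v hv he' hf'
    exact hfinv
  -- (L10)
  have h10 : CoinvariantsTrivialAt (W.baseChange K) p κ 𝔭 γ :=
    coinvariantsTrivialAt_of_not_split W p hp3 hmult hns (hPT K) (hPT2 K) (hEP K) hcd hK hsplit κ
      hγ.out h𝔭 he hf hfin
  -- (P9) from finiteness at the conjugate prime
  obtain ⟨σ, 𝔮, -, hne, h𝔮, -⟩ :=
    LocalIndexTransport.exists_conj_prime_of_splitsIn K p hK.1 hsplit h𝔭
  have h9 : LocSurjAt (W.baseChange K) p 𝔭 (nPlusPlaces_finite (W := W) (p := p) hK.1) :=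
    locSurjAt_of_finite_conj_of_not_split W p hp3 hmult hns (hPT K) (hEP K) hK κ h𝔭 he hf h𝔮 hne
      (hfin 𝔮 h𝔮)
  -- (P11) from Brink's decomposition law, and the assembly
  exact controlOnTreeAt_of_atoms_of_not_split W p hp3 hmult hns hK hsplit hκ γ 𝔭 h𝔭 he hf
    (embAt K p 𝔭 h𝔭 he hf) P (h6 𝔭 h𝔭 he hf) h9 h10
    (r1LocalKernelOrderAt_of_anticyclotomicDecomposition W p hBr hp2 K hK κ hκ)

end NonSplit

/-! ### §3 Both signs; Brink, Milne I 2.8 and `cd_p ≤ 2` discharged -/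

section Both

variable (W : WeierstrassCurve ℚ) [W.IsElliptic] [W.IsGloballyMinimal] (p : ℕ) [Fact p.Prime]

/-- **Cas18 Thm. 2.3 ∕ JSW17 Thm. 3.3.1 on the constructed `X_ac` at EVERY multiplicative rank-one datum on JSW's inputs**: `p` odd
multiplicative, `K` imaginary quadratic with `p` split, `rank E(K) = 1`, `Ш(E/K)[p^∞]` finite, `P` of infinite order, `κ` anticyclotomic
with generator `γ`, `𝔭 ∣ p` of degree one ⟹ `ControlOnTreeAt p κ 𝔭 γ (embAt K p 𝔭) P`. Cases on the sign at `p`; the cited facts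
consumed BY NAME are `hPT`, `hPT2` only (Brink Thm. 2, Milne I 2.8, `cd_p ≤ 2` are the tree theorems
`ZpExtension.decomp_not_le_kerSubgroup_of_isAnticyclotomic_holds`, `localEulerPoincareCharacteristic_holds`,
`fieldCdLE_two_of_numberField_holds`). [cite: Castella2018, Thm. 2.3 (arXiv:1704.06608 p. 5)]
[cite: JetchevSkinnerWan2017, Thm. 3.3.1 with §3.5 (3.5.c) (arXiv:1512.06894 pp. 11, 15)] -/
theorem controlOnTreeAt_of_mult_of_rankOne_shaPrimary
    (hPT : ∀ (K : Type) [Field K] [NumberField K], poitouTate_selmerStructure_duality K)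
    (hPT2 : ∀ (K : Type) [Field K] [NumberField K], poitouTate_sha_tateDual K)
    (hp2 : p ≠ 2) (hmult : Mult W p)
    {K : Type} [Field K] [NumberField K] (hK : IsImaginaryQuadratic K) (hsplit : SplitsIn K p)
    (hrank : (W.baseChange K).mordellWeilRank = 1)
    (hSha : Finite (AddCommGroup.primaryComponent (W.baseChange K).sha p))
    (P : (W.baseChange K).toAffine.Point) (hPinf : ¬ IsOfFinAddOrder P)
    (κ : ZpExtension K p) (hκ : κ.IsAnticyclotomic) (γ : absoluteGaloisGroup K)
    [Fact (κ.IsTopGenerator γ)] (𝔭 : HeightOneSpectrum (𝓞 K))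
    (h𝔭 : ((p : ℕ) : 𝓞 K) ∈ 𝔭.asIdeal) (he : 𝔭.asIdeal.ramificationIdx (𝓞 ℚ) = 1)
    (hf : 𝔭.asIdeal.inertiaDeg (𝓞 ℚ) = 1) :
    ControlOnTreeAt p κ 𝔭 γ (embAt K p 𝔭 h𝔭 he hf) P := by
  have hEP : ∀ (K : Type) [Field K] [NumberField K] (v : HeightOneSpectrum (𝓞 K)),
      localEulerPoincareCharacteristic (v.adicCompletion K) := fun K _ _ v ↦
    haveI : CharZero (v.adicCompletion K) := charZero_of_injective_algebraMap (algebraMap K _).injective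
    localEulerPoincareCharacteristic_holds (v.adicCompletion K)
  have hBr : ∀ (K : Type) [Field K] [NumberField K] (p : ℕ) [Fact p.Prime],
      ZpExtension.decomp_not_le_kerSubgroup_of_isAnticyclotomic K p := fun K _ _ p _ ↦
    ZpExtension.decomp_not_le_kerSubgroup_of_isAnticyclotomic_holds (K := K) (p := p)
  by_cases hsW : W.HasSplitMultiplicativeReductionAtPrime p
  · exact CtlLoc.controlOnTreeAt_of_split_of_rankOne_shaPrimary W p hPT hPT2 hEP hBr hp2 hsW hK hsplit hrank
      hSha P hPinf κ hκ γ 𝔭 h𝔭 he hf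
  · exact controlOnTreeAt_of_not_split_of_rankOne_shaPrimary W p hPT hPT2 hEP fieldCdLE_two_of_numberField_holds
      hBr hp2 hmult hsW hK hsplit hrank hSha P hPinf κ hκ γ 𝔭 h𝔭 he hf

end Both

/-! ### §4 An embedding of the quadratic field inducing `v` IS `embAt K p v` -/

section Embedding

variable {K : Type} [Field K] [NumberField K] {p : ℕ} [Fact p.Prime]

/-- **`ι = embAt K p v`** for an embedding `ι : K →+* ℚ_p` of the quadratic field `K` (`p` split) that induces the prime `v` on `𝓞 K`
(`x ∈ v ↔ ‖ι x‖ < 1` — the binder of JSW17 Thm. 3.3.1 as typed); in particular `p ∈ v` and `v` has degree one. From bsd-schneider's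
`eq_comp_embAt_of_forall_mem_iff_norm_lt_one` (with `e = id`) and the conjugate prime `v̄ ≠ v`.
[cite: FrohlichTaylor1990, Ch. III §1 (1.14)(a)] [cite: CastellaHsieh2018, §3.3 (arXiv:1505.08165 p. 9)] -/
theorem ringHom_eq_embAt_of_forall_mem_iff (h2 : Module.finrank ℚ K = 2) (hsplit : SplitsIn K p)
    (ι : K →+* ℚ_[p]) (v : HeightOneSpectrum (𝓞 K)) (hv : ∀ x : 𝓞 K, x ∈ v.asIdeal ↔ ‖ι (x : K)‖ < 1)
    (hpv : ((p : ℕ) : 𝓞 K) ∈ v.asIdeal) (he : v.asIdeal.ramificationIdx (𝓞 ℚ) = 1)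
    (hf : v.asIdeal.inertiaDeg (𝓞 ℚ) = 1) :
    ι = embAt K p v hpv he hf := by
  obtain ⟨σ, w, -, hne, hw, -⟩ := LocalIndexTransport.exists_conj_prime_of_splitsIn K p h2 hsplit hpv
  obtain ⟨hew, hfw⟩ := degreeOne_of_splitsIn h2 hsplit hw
  refine RingHom.ext fun x ↦ ?_
  exact SchneiderFree.KYRead.LogDescent.eq_comp_embAt_of_forall_mem_iff_norm_lt_one h2 hw hew hfw hpv he hf
    hne (RingHom.id ℚ_[p]) (fun _ ↦ rfl) ι hv x

end Embedding

/-! ### §5 JSW17 Thm. 3.3.1 at a multiplicative `p` (item 19626 VERBATIM) from the two Poitou–Tate facts -/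

section JSW

/-- **Jetchev–Skinner–Wan 2017 Thm. 3.3.1 with (3.5.c) at a multiplicative `p` — the route's support item 19626
`JSWAnticyclotomicControlMult` = `JetchevSkinnerWan2017.thm331_anticyclotomicControl_mult` VERBATIM — from the two Poitou–Tate facts.**
At every datum of the fact (`W/ℚ` globally minimal, `3 ≤ p`, `Mult W p`, `K` imaginary quadratic with `p` split, (irred_K), `ι` inducing
the strict prime `v`, `κ` anticyclotomic with generator `γ`, `rank E(K) = 1`, `#Ш(E/K)[p^∞] < ∞`, `P` of infinite order): `ι = embAt K p v`
(§4), the control identity `ControlOnTreeAt p κ v γ (embAt K p v) P` (§3), and the defeq bridges to the Literature currency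
(`AcSelmer.hasCharValuationAt_iff_literature`, `tamagawaProductSplit_eq_literature`, `padicLogOrd_eq_literature`). (irred_K) is not used.
CONDITIONAL on `hPT`, `hPT2` (cited facts BY NAME) — a conditional-result for item 19626; Brink, Milne I 2.8, `cd_p ≤ 2`, Mazur control,
Greenberg's Lemma 4.2 and the base count are kernel theorems. [cite: JetchevSkinnerWan2017, Thm. 3.3.1 (arXiv:1512.06894 Thm. 8, p. 11) with Prop. 3.2.1, §3.3.3, §3.5 (3.5.c) (p. 15)]
[cite: Castella2018, proof of Thm. 2.3, (eq:calcul)–(eq:tam-p) (arXiv:1704.06608 p. 6)] [cite: MilneADT2006, Ch. I, Thm. 4.10 and Thm. 2.8] -/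
theorem thm331_anticyclotomicControl_mult_of_poitouTate
    (hPT : ∀ (K : Type) [Field K] [NumberField K], poitouTate_selmerStructure_duality K)
    (hPT2 : ∀ (K : Type) [Field K] [NumberField K], poitouTate_sha_tateDual K) :
    JetchevSkinnerWan2017.thm331_anticyclotomicControl_mult := by
  intro W _ _ p _ hp3 hmult K _ _ hK hHp _hirrK ι v hv κ hκ γ _ hrank hfin P hP
  have hp2 : p ≠ 2 := by omega
  have hsplit : SplitsIn K p := hHp p Fact.out (dvd_refl p)
  have hpv : ((p : ℕ) : 𝓞 K) ∈ v.asIdeal := natCast_mem_of_forall_mem_iff_norm_lt ι v hv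
  obtain ⟨he, hf⟩ := degreeOne_of_splitsIn hK.1 hsplit hpv
  have hι : ι = embAt K p v hpv he hf := ringHom_eq_embAt_of_forall_mem_iff hK.1 hsplit ι v hv hpv he hf
  subst hι
  obtain ⟨n, hn, hval⟩ := controlOnTreeAt_of_mult_of_rankOne_shaPrimary W p hPT hPT2 hp2 hmult hK hsplit hrank hfin P hP
    κ hκ γ v hpv he hf
  obtain ⟨htors, F, hF, hF0, hFn⟩ := (AcSelmer.hasCharValuationAt_iff_literature _ p κ v ∅ γ n).mp hn
  refine ⟨htors, F, hF, hF0, ?_⟩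
  rw [hFn, ← tamagawaProductSplit_eq_literature, ← padicLogOrd_eq_literature]
  exact hval

end JSW

end Summit.BirchSwinnertonDyer.BirchSwinnertonDyer.Theorems.JSWControl

end
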